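import Summits.QuantumFields.BalabanUV.Beta.D1BFx.ShellGradedRoad
import Summits.QuantumFields.BalabanUV.Beta.D1BFx.RoadEnd

/-!
# `BalabanUV.Beta.D1BFx.ShellRoadEnd` — road «BF-x» for binder row D1, sub-leaf C3-SHELL (the C3 twin):
# THE STRONG GRADING CLOSES THE WALL WITH THE MIXED-SECOND-DIFFERENCE ROWS h2/d2 IN SHELL-ℓ¹ CURRENCY

HONEST DEPENDENCY (page 1, mandatory): continuum YM on T⁴ ⇐ BetaPertH ∧ nine spine estimates (0/9 proved); BetaPertH ⇐ (D1) ∧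
(D4) ∧ CAP+tail; G-an2-4 gates asym, D1 and NE2/3/4.  HONEST FRAMING (cell contract, verbatim): «discharging `BetaPertH` makes
Bałaban's UV stability UNCONDITIONAL — a real constructive-QFT result; it is NOT the continuum limit and NOT the Clay problem.»
THIS MODULE DISCHARGES NOTHING of the wall: [folklore] sequence algebra copied from `RoadEnd.d1Drift_of_strongRoad` (C3) with an3's
pointwise scalar END replaced BY NAME by this unit's `ShellGradedRoad.oneLoopDrift_of_scalarShellBounds_avg`.  Every binder is a HYPOTHESIS
with free constants; the one-shot coefficient `c` and the scalar leg family `Gf` are FREE PARAMETERS.  No `def`, no `Prop` mirror, no cited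
fact, 0 sorry.  0 wall binders instantiated; NOT D1, NOT `BetaPertH`, NOT continuum, NOT Clay.

ABSOLUTE RULE (cell charter, verbatim): «No internally-minted statement may enter as a cited fact. Every hypothesis is either
kernel-proved in this package or a verbatim quotation of a PUBLISHED theorem with page reference. The manuscript(s) under audit are NOT
citable for their own disputed steps — they are the thing under adjudication; programme-internal (2001/route/tribunal) claims are never
citable.»

CONTENT.  `d1Drift_of_strongRoad_shell` — EXACTLY the binder list of `RoadEnd.d1Drift_of_strongRoad` (bridge B1 `hB1`, target T `hT`, convex
base-point weights, rows `h0/h1/d0/d1` VERBATIM) except that the mixed-second-difference rows are SHELL-SUMMED: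
`h2s : ∀ n ≥ 2, ∀ b, ∀ r, r + 1 ≤ n → Σ_{‖v‖∞=r+1}|D_{μν}(Gf n b − gFree)(v)| ≤ D₂/n` and
`d2s : ∀ n ≥ 2, ∀ b, ∀ r ≥ n, Σ_{‖v‖∞=r+1}|D_{μν}(Gf n b)(v)| ≤ A₂e^{−(δ/n)(r+1)}/(r+1)` (window cut-off `M n := n` as in C3) ⟹
`OneStepKernelFamily.D1Drift Lc Js N μ ν`.  The tree's pointwise `h2`/`d2` imply `h2s`/`d2s` (`#shell ≤ 80(r+1)³`), so this END is strictly
MORE GENERAL than C3.  WHY: gen 3 of this unit found (evidence-grade) that the pointwise `h2` is off by `log n` on the block-edge layer for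
the actual legs while the shell sums are of the typed size (journal RESULT l.10890; ENGINE-2 by beta-num-g33 pending); see
`D1BFx/ShellWindowInterface` for the located reading of where the wall consumes the rows.
Unit `b2b-balaban-beta-d1-formalise-leaf-07` (gen 4), D1 formalisation swarm; `LEAVES-BFx.md` sub-row C3-SHELL; journal CLAIM l.11259.
-/

open Finset Filter Topology
open scoped BigOperators
open Literature.Probability.LatticeModels (annulus)
open Literature.MathematicalPhysics.QuantumFieldTheory.Balaban1983to89
open Literature.MathematicalPhysics.QuantumFieldTheory.Balaban1983to89.Beta
open OneStepResolventKernel (JetData)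
open OneStepKernelFamily (TbalOf D1Drift)
open MarginalTelescoping (composedCoeff IdentityForm)
open WindowIdentification (fullSum)
open DyadicShell (Pt supNorm)
open SquareTable (stK)
open GhostTable (gFree)
open BubbleTransfer (unitVec)
open ScalewiseVectorSeam (splitOf)
open Summit.QuantumFields.BalabanUV.Beta.D1BFx.ShellGradedRoad (oneLoopDrift_of_scalarShellBounds_avg)

namespace Summit.QuantumFields.BalabanUV.Beta.D1BFx.ShellRoadEnd

variable {Lc : ℕ} [NeZero Lc] {κB : Type*}

/-- [folklore] **C3 (STRONG GRADING), SHELL CURRENCY FOR THE MIXED DIFFERENCES.**  For ANY jet data `Js` and channel `μ ≠ ν`: a BOUNDED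
telescoping defect of the step coefficients `β⁰_j := secondMoment (TbalOf Lc Js j) μ ν` against a one-shot coefficient `c (Lc^m)` (bridge B1),
the road's target T (`|c (Lc^m) − Σ_b wt b · fullSum (stK μ ν N (Gf (Lc^m) b))| ≤ U₂`, convex weights), the four POINTWISE scalar rows
`h0/h1/d0/d1` of C3 VERBATIM and the two SHELL-SUMMED rows `h2s` (`Σ_{‖v‖∞=r+1}|D_{μν}E_n(v)| ≤ D₂/n`, `r + 1 ≤ n`) / `d2s`
(`Σ_{‖v‖∞=r+1}|D_{μν}G_n(v)| ≤ A₂e^{−(δ/n)(r+1)}/(r+1)`, `r ≥ n`) ⟹ THE WALL'S LITERAL TERM `D1Drift Lc Js N μ ν` — through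
`ShellGradedRoad.oneLoopDrift_of_scalarShellBounds_avg` at the trivial instance `μC j m := β⁰_j`, `IdentityForm` by `rfl`, carrier `splitOf β⁰`,
window cut-off `M n := n`, `cc := 1`. -/
theorem d1Drift_of_strongRoad_shell (Js : ℕ → JetData 3 Lc) {μ ν : Fin 4} (hμν : μ ≠ ν) {N : ℝ} (hN : N ≠ 0) (hL : 2 ≤ Lc)
    (c : ℕ → ℝ) {Bset : ℕ → Finset κB} {wt : ℕ → κB → ℝ} {Gf : ℕ → κB → Pt → ℝ} {D A : ℕ → ℝ}
    (hD : ∀ j, 0 ≤ D j) (hA : ∀ j, 0 ≤ A j) {δ U₁ U₂ : ℝ} (hδ : 0 < δ)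
    (hwt0 : ∀ n : ℕ, 2 ≤ n → ∀ b ∈ Bset n, 0 ≤ wt n b) (hwt1 : ∀ n : ℕ, 2 ≤ n → ∑ b ∈ Bset n, wt n b = 1)
    (h0 : ∀ n : ℕ, 2 ≤ n → ∀ b ∈ Bset n, ∀ v, |Gf n b v - gFree v| ≤ D 0 / (n : ℝ) ^ 2)
    (h1 : ∀ n : ℕ, 2 ≤ n → ∀ b ∈ Bset n, ∀ v (ρ : Fin 4),
      |(Gf n b (v + unitVec ρ) - gFree (v + unitVec ρ)) - (Gf n b v - gFree v)| ≤ D 1 / (n : ℝ) ^ 3)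
    (h2s : ∀ n : ℕ, 2 ≤ n → ∀ b ∈ Bset n, ∀ r : ℕ, r + 1 ≤ n →
      ∑ v ∈ annulus 4 r (r + 1), |(Gf n b (v + unitVec ν + unitVec μ) - gFree (v + unitVec ν + unitVec μ)) -
          (Gf n b (v + unitVec ν) - gFree (v + unitVec ν)) - (Gf n b (v + unitVec μ) - gFree (v + unitVec μ)) +
          (Gf n b v - gFree v)| ≤ D 2 / (n : ℝ))
    (d0 : ∀ n : ℕ, 2 ≤ n → ∀ b ∈ Bset n, ∀ v : Pt, v ≠ 0 → |Gf n b v| ≤ A 0 * Real.exp (-(δ / n) * supNorm v) / (supNorm v : ℝ) ^ 2)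
    (d1 : ∀ n : ℕ, 2 ≤ n → ∀ b ∈ Bset n, ∀ v : Pt, v ≠ 0 → ∀ ρ : Fin 4,
      |Gf n b (v + unitVec ρ) - Gf n b v| ≤ A 1 * Real.exp (-(δ / n) * supNorm v) / (supNorm v : ℝ) ^ 3)
    (d2s : ∀ n : ℕ, 2 ≤ n → ∀ b ∈ Bset n, ∀ r : ℕ, n ≤ r →
      ∑ v ∈ annulus 4 r (r + 1), |Gf n b (v + unitVec ν + unitVec μ) - Gf n b (v + unitVec ν) - Gf n b (v + unitVec μ) + Gf n b v| ≤
        A 2 * Real.exp (-(δ / n) * ((r : ℝ) + 1)) / ((r : ℝ) + 1))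
    (hB1 : ∀ m : ℕ, 1 ≤ m → |(∑ j ∈ range m, B12Beta.secondMoment (TbalOf Lc Js j) μ ν) - c (Lc ^ m)| ≤ U₁)
    (hT : ∀ m : ℕ, 1 ≤ m → |c (Lc ^ m) - ∑ b ∈ Bset (Lc ^ m), wt (Lc ^ m) b * fullSum (stK μ ν N (Gf (Lc ^ m) b))| ≤ U₂) :
    D1Drift Lc Js N μ ν := by
  set β0 : ℕ → ℝ := fun j => B12Beta.secondMoment (TbalOf Lc Js j) μ ν with hβ0
  have hid : IdentityForm (fun j _ => β0 j) (splitOf β0).β0 := fun _ _ _ => rfl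
  have hcomp : ∀ m, composedCoeff (fun j _ => β0 j) m = ∑ j ∈ range m, β0 j := fun _ => rfl
  have hU : ∀ m : ℕ, 1 ≤ m →
      |composedCoeff (fun j _ => β0 j) m - ∑ b ∈ Bset (Lc ^ m), wt (Lc ^ m) b * fullSum (stK μ ν N (Gf (Lc ^ m) b))| ≤ U₁ + U₂ := by
    intro m hm
    rw [hcomp]
    calc |(∑ j ∈ range m, β0 j) - ∑ b ∈ Bset (Lc ^ m), wt (Lc ^ m) b * fullSum (stK μ ν N (Gf (Lc ^ m) b))|
        = |((∑ j ∈ range m, β0 j) - c (Lc ^ m)) +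
            (c (Lc ^ m) - ∑ b ∈ Bset (Lc ^ m), wt (Lc ^ m) b * fullSum (stK μ ν N (Gf (Lc ^ m) b)))| := by ring_nf
      _ ≤ |(∑ j ∈ range m, β0 j) - c (Lc ^ m)| +
            |c (Lc ^ m) - ∑ b ∈ Bset (Lc ^ m), wt (Lc ^ m) b * fullSum (stK μ ν N (Gf (Lc ^ m) b))| := abs_add_le _ _
      _ ≤ U₁ + U₂ := add_le_add (hB1 m hm) (hT m hm)
  -- window cut-off M n := n, cc := 1
  have hc : (1 : ℝ) ≤ 1 := le_rfl
  have hM : ∀ L : ℕ, 2 ≤ L → 1 ≤ (fun n : ℕ => n) L ∧ (L : ℝ) ≤ 1 * ((fun n : ℕ => n) L : ℕ) := fun L hL2 =>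
    ⟨le_trans (by norm_num) hL2, by simp⟩
  have hML : ∀ L : ℕ, 2 ≤ L → (fun n : ℕ => n) L ≤ L := fun _ _ => le_rfl
  exact ⟨_, oneLoopDrift_of_scalarShellBounds_avg (splitOf β0) hμν hN hL (μC := fun j _ => β0 j) (M := fun n : ℕ => n) hD hA hδ hwt0
    hwt1 hc hM hML h0 h1 (fun n hn b hb r hr => h2s n hn b hb r hr) d0 d1 (fun n hn b hb r hr => d2s n hn b hb r hr) hU hid⟩

end Summit.QuantumFields.BalabanUV.Beta.D1BFx.ShellRoadEnd
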